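import Mathlib.Analysis.SpecialFunctions.Integrals.Basic
import Literature.NumberTheory.LFunctions.MontgomeryTheoremGoldstonMontgomery
import HarnessLib

/-!
# Montgomery's theorem integrated over windows in `[−1, 1]` (the RH-only inputs of BGSTB 2025, §7)

Topic `Literature/NumberTheory/LFunctions` (namespace `Literature.NumberTheory.LFunctions.Montgomery`).
Proofs only: no definitions, no named facts. LABEL: RH is the printed ANTECEDENT (as in Montgomery 1973);
nothing here bears on the truth of RH.

Baluyot–Goldston–Suriajaya–Turnage-Butterbaugh 2025 prove their Theorem 3 (the shape of `∫_a^b F(α) g(α) dα`)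
by cutting `[a, b]` into windows; on the windows inside `[−1, 1]` only Montgomery's theorem (MT) is used
(§7, proof of Theorem 3: "For `L = 0`, we have, since `F` is even, `∫_{−λ}^{λ} F(β) dβ = 2∫_{−λ}^0 F(β) dβ
= 2∫_0^λ F(β) dβ`, and assuming only RH we apply MT and have `∫_0^λ F(β) dβ = ½ + O(λ) + o(1)`"; §6,
Lemma 6 (ii) inside `(−1, 1)`: "`(1/2λ) ∫_{α−λ}^{α+λ} F(β) dβ = s(α) + O(λ) + …`", `s(α) = |α|` there; Lemma 6
(iv): "`∫_{1−λ}^{1+λ} F(α) dα = ∫_1^{1+λ} F(α) dα + O(λ)`", whose content is `∫_{1−λ}^{1} F = O(λ)`, from (MT)).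
Here these window integrals are derived, with explicit uniformity, from the tree's Montgomery theorem with
the Goldston–Montgomery error term on the closed interval (`Montgomery.montgomery_pair_correlation_sqrtLog_Icc`,
file `MontgomeryTheoremGoldstonMontgomery.lean`):

* `Montgomery.exists_abs_integral_formFactor_sub_le` — (W1) there is `C` with, for all large `T` and ALL
  `0 ≤ a ≤ b ≤ 1`, `|∫_a^b F(β,T) dβ − ((T^{−2a} − T^{−2b})/2 + (b² − a²)/2)| ≤ C/√(log T)`
  (integrate `F = T^{−2β} log T + β + O((T^{−2β} log T + 1)/√log T)`; `∫_a^b T^{−2β} log T dβ = (T^{−2a} − T^{−2b})/2`);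
* `Montgomery.integral_formFactor_comp_neg` — `∫_{−b}^{−a} F = ∫_a^b F` (evenness);
* `Montgomery.exists_abs_integral_formFactor_zero_sub_half_le` — (W2) `|∫_0^λ F − ½ − λ²/2| ≤ C/√log T + T^{−2λ}/2`
  for `0 < λ ≤ 1` (BGSTB §7: "`∫_0^λ F = ½ + O(λ) + o(1)`");
* `Montgomery.exists_abs_integral_formFactor_symm_sub_one_le` — `|∫_{−λ}^{λ} F − 1 − λ²| ≤ C/√log T + T^{−2λ}`
  (the `L = 0` case of Lemma 6 (i), RH alone);
* `Montgomery.exists_abs_integral_formFactor_window_sub_le` — for `λ ≤ a`, `a + λ ≤ 1`: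
  `|∫_{a−λ}^{a+λ} F − 2λa| ≤ C/√log T + T^{−2(a−λ)}/2` (the `s(α) = |α|` windows of Lemma 6 (ii) inside `(0,1)`,
  from RH alone);
* `Montgomery.exists_formFactor_le_of_half_le`, `Montgomery.exists_integral_formFactor_left_of_one_le` —
  `F(β,T) ≤ C'` on `[½, 1]` and `∫_{1−λ}^{1} F ≤ C' λ` for `0 ≤ λ ≤ ½`, all large `T` (the (MT) content of
  Lemma 6 (iv)).

The weighted version (test functions `g`: the `[a, b] ⊆ [−1, 1]` case of BGSTB Theorem 3 from RH alone) is the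
companion file `MontgomeryTheoremTestFunctions.lean`.

## References

* [BaluyotGoldstonSuriajayaTurnageButterbaugh2025] arXiv:2508.10857, §2 (MT), §6 Lemma 6 (ii)/(iv), §7 (proof
  of Theorem 3, the case `L = 0`). [claim: BaluyotGoldstonSuriajayaTurnageButterbaugh2025, status: under-review]
* [GoldstonMontgomery1987] D. A. Goldston, H. L. Montgomery, Progr. Math. 70 (1987), §3 Lemma 8 (the input (MT)).
* [Montgomery1973] H. L. Montgomery, *The pair correlation of zeros of the zeta function*, Theorem.
-/

noncomputable section

open Filter Set MeasureTheory Real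

namespace Literature.NumberTheory.LFunctions

namespace Montgomery

/-- `∫_a^b e^{−c x} dx = (e^{−c a} − e^{−c b})/c` (`c ≠ 0`). [folklore] -/
private theorem integral_exp_neg_mul_eq {c : ℝ} (hc : c ≠ 0) (a b : ℝ) :
    ∫ x in a..b, Real.exp (-c * x) = (Real.exp (-c * a) - Real.exp (-c * b)) / c := by
  rw [intervalIntegral.integral_comp_mul_left (fun x ↦ Real.exp x) (neg_ne_zero.2 hc), integral_exp]
  simp only [smul_eq_mul]
  field_simp
  ring

/-- `F(·, T)` is continuous (a finite cosine sum). [folklore] -/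
private theorem continuous_formFactor_left (T : ℝ) :
    Continuous fun a : ℝ ↦ montgomeryFormFactor a T := by
  unfold montgomeryFormFactor
  fun_prop

/-- Evenness under the integral: `∫_{−b}^{−a} F(β,T) dβ = ∫_a^b F(β,T) dβ` (`F(−β) = F(β)`,
`montgomeryFormFactor_neg`; BGSTB §7: "since `F` is even, `∫_{−λ}^{λ} F = 2∫_{−λ}^0 F = 2∫_0^λ F`").
[cite: BaluyotGoldstonSuriajayaTurnageButterbaugh2025, §7 (proof of Theorem 3)] -/
theorem integral_formFactor_comp_neg (a b T : ℝ) :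
    ∫ β in (-b)..(-a), montgomeryFormFactor β T = ∫ β in a..b, montgomeryFormFactor β T := by
  have h := intervalIntegral.integral_comp_neg (a := a) (b := b) (fun β : ℝ ↦ montgomeryFormFactor β T)
  simp only [montgomeryFormFactor_neg] at h
  rw [← h]

/-- `∫_{−λ}^{λ} F = 2 ∫_0^λ F`. [cite: BaluyotGoldstonSuriajayaTurnageButterbaugh2025, §7 (proof of Theorem 3)] -/
theorem integral_formFactor_symm (lam T : ℝ) :
    ∫ β in (-lam)..lam, montgomeryFormFactor β T = 2 * ∫ β in (0 : ℝ)..lam, montgomeryFormFactor β T := by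
  have hc : ∀ u v : ℝ, IntervalIntegrable (fun β : ℝ ↦ montgomeryFormFactor β T) volume u v :=
    fun u v ↦ (continuous_formFactor_left T).intervalIntegrable u v
  rw [← intervalIntegral.integral_add_adjacent_intervals (hc (-lam) 0) (hc 0 lam),
    ← neg_zero, integral_formFactor_comp_neg 0 lam T, neg_zero]
  ring

/-- **(W1) Montgomery's theorem integrated over a window `[a, b] ⊆ [0, 1]`**: assuming RH there is `C`
such that for all large `T` and all `0 ≤ a ≤ b ≤ 1`,
`|∫_a^b F(β,T) dβ − ((T^{−2a} − T^{−2b})/2 + (b² − a²)/2)| ≤ C/√(log T)`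
(integrate (MT) with the Goldston–Montgomery error term; `∫_a^b T^{−2β} log T dβ = (T^{−2a} − T^{−2b})/2`).
[cite: BaluyotGoldstonSuriajayaTurnageButterbaugh2025, §7 (proof of Theorem 3)] -/
theorem exists_abs_integral_formFactor_sub_le (hRH : RiemannHypothesis) :
    ∃ C : ℝ, 0 ≤ C ∧ ∀ᶠ T : ℝ in atTop, ∀ a b : ℝ, 0 ≤ a → a ≤ b → b ≤ 1 →
      |(∫ β in a..b, montgomeryFormFactor β T) -
          ((T ^ (-2 * a) - T ^ (-2 * b)) / 2 + (b ^ 2 - a ^ 2) / 2)| ≤ C / Real.sqrt (Real.log T) := by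
  obtain ⟨C₃, hC₃⟩ := montgomery_pair_correlation_sqrtLog_Icc hRH
  refine ⟨2 * |C₃|, by positivity, ?_⟩
  filter_upwards [hC₃, eventually_ge_atTop 3] with T hF hT3
  intro a b ha hab hb
  have hT0 : 0 < T := by linarith
  set L : ℝ := Real.log T with hL
  have hL0 : 0 < L := Real.log_pos (by linarith)
  set s : ℝ := Real.sqrt L with hs
  have hs0 : 0 < s := Real.sqrt_pos.2 hL0
  set E : ℝ → ℝ := fun β ↦ Real.exp (-(2 * L) * β) with hEdef
  have hE : ∀ β : ℝ, T ^ (-2 * β) = E β := fun β ↦ by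
    rw [hEdef, Real.rpow_def_of_pos hT0]; congr 1; ring
  have hE0 : ∀ β, 0 < E β := fun β ↦ Real.exp_pos _
  have hEc : Continuous E := by rw [hEdef]; fun_prop
  have hIE : ∫ β in a..b, E β = (E a - E b) / (2 * L) := by
    rw [hEdef]; exact integral_exp_neg_mul_eq (by positivity) a b
  -- the main term
  have hFi : IntervalIntegrable (fun β ↦ montgomeryFormFactor β T) volume a b :=
    (continuous_formFactor_left T).intervalIntegrable a b
  have hMi : IntervalIntegrable (fun β ↦ E β * L + β) volume a b :=
    ((hEc.mul continuous_const).add continuous_id).intervalIntegrable a b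
  have i1 : IntervalIntegrable (fun β ↦ E β * L) volume a b :=
    (hEc.mul continuous_const).intervalIntegrable a b
  have i2 : IntervalIntegrable (fun β : ℝ ↦ β) volume a b := continuous_id.intervalIntegrable a b
  have hmain : ∫ β in a..b, (E β * L + β) = (E a - E b) / 2 + (b ^ 2 - a ^ 2) / 2 := by
    rw [intervalIntegral.integral_add i1 i2, intervalIntegral.integral_mul_const, hIE, integral_id]
    field_simp
  -- the pointwise bound and its integral
  have hpt : ∀ β ∈ Set.Ioc a b,
      ‖montgomeryFormFactor β T - (E β * L + β)‖ ≤ |C₃| / s * (L * E β + 1) := by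
    intro β hβ
    have h := hF β ⟨ha.trans hβ.1.le, hβ.2.trans hb⟩
    rw [hE β] at h
    rw [Real.norm_eq_abs]
    refine h.trans ?_
    rw [mul_comm (E β) L, div_mul_eq_mul_div]
    exact div_le_div_of_nonneg_right
      (mul_le_mul_of_nonneg_right (le_abs_self C₃) (by positivity)) hs0.le
  have hbi : IntervalIntegrable (fun β ↦ |C₃| / s * (L * E β + 1)) volume a b :=
    (continuous_const.mul ((continuous_const.mul hEc).add continuous_const)).intervalIntegrable a b
  have i3 : IntervalIntegrable (fun β ↦ L * E β) volume a b :=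
    (continuous_const.mul hEc).intervalIntegrable a b
  have i4 : IntervalIntegrable (fun _ : ℝ ↦ (1 : ℝ)) volume a b := intervalIntegrable_const
  have hIb : ∫ β in a..b, |C₃| / s * (L * E β + 1) = |C₃| / s * ((E a - E b) / 2 + (b - a)) := by
    rw [intervalIntegral.integral_const_mul, intervalIntegral.integral_add i3 i4,
      intervalIntegral.integral_const_mul, hIE, intervalIntegral.integral_const, smul_eq_mul, mul_one]
    congr 1
    field_simp
  have hnorm := intervalIntegral.norm_integral_le_of_norm_le hab (Eventually.of_forall hpt) hbi
  rw [intervalIntegral.integral_sub hFi hMi, hmain, hIb, Real.norm_eq_abs] at hnorm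
  rw [hE a, hE b]
  refine hnorm.trans ?_
  have hEa1 : E a ≤ 1 := by
    rw [hEdef]; exact Real.exp_le_one_iff.2 (by nlinarith)
  have h1 : (E a - E b) / 2 + (b - a) ≤ 2 := by linarith [hE0 b]
  calc |C₃| / s * ((E a - E b) / 2 + (b - a)) ≤ |C₃| / s * 2 :=
        mul_le_mul_of_nonneg_left h1 (by positivity)
    _ = 2 * |C₃| / s := by ring

/-- **(W2) the window at `0`** (BGSTB 2025, §7: "assuming only RH we apply MT and have
`∫_0^λ F(β) dβ = ½ + O(λ) + o(1)`"; here with `λ²/2` and the explicit `o(1)`): assuming RH there is `C`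
with, for all large `T` and all `0 < λ ≤ 1`, `|∫_0^λ F(β,T) dβ − ½ − λ²/2| ≤ C/√(log T) + T^{−2λ}/2`.
[cite: BaluyotGoldstonSuriajayaTurnageButterbaugh2025, §7 (proof of Theorem 3)] -/
theorem exists_abs_integral_formFactor_zero_sub_half_le (hRH : RiemannHypothesis) :
    ∃ C : ℝ, 0 ≤ C ∧ ∀ᶠ T : ℝ in atTop, ∀ lam : ℝ, 0 < lam → lam ≤ 1 →
      |(∫ β in (0 : ℝ)..lam, montgomeryFormFactor β T) - 1 / 2 - lam ^ 2 / 2| ≤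
        C / Real.sqrt (Real.log T) + T ^ (-2 * lam) / 2 := by
  obtain ⟨C, hC0, hC⟩ := exists_abs_integral_formFactor_sub_le hRH
  refine ⟨C, hC0, ?_⟩
  filter_upwards [hC, eventually_gt_atTop 0] with T hT hT0
  intro lam hlam0 hlam1
  have h := hT 0 lam le_rfl hlam0.le hlam1
  rw [mul_zero, Real.rpow_zero] at h
  have hpos : 0 < T ^ (-2 * lam) := Real.rpow_pos_of_pos hT0 _
  have e : (∫ β in (0 : ℝ)..lam, montgomeryFormFactor β T) - 1 / 2 - lam ^ 2 / 2 =
      ((∫ β in (0 : ℝ)..lam, montgomeryFormFactor β T) -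
        ((1 - T ^ (-2 * lam)) / 2 + (lam ^ 2 - 0 ^ 2) / 2)) - T ^ (-2 * lam) / 2 := by ring
  rw [e]
  refine (abs_sub _ _).trans ?_
  rw [abs_of_pos (by positivity : 0 < T ^ (-2 * lam) / 2)]
  linarith

/-- **The `L = 0` case of BGSTB 2025, Lemma 6 (i), from RH alone** ("`∫_{2L−λ}^{2L+λ} F(β) dβ = 1 + O(λ²) + …`";
at `L = 0` no AH-Pairs is needed: `∫_{−λ}^{λ} F = 2∫_0^λ F`): assuming RH there is `C` with, for all large `T`
and all `0 < λ ≤ 1`, `|∫_{−λ}^{λ} F(β,T) dβ − 1 − λ²| ≤ C/√(log T) + T^{−2λ}`.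
[cite: BaluyotGoldstonSuriajayaTurnageButterbaugh2025, §6 Lemma 6 (i)] -/
theorem exists_abs_integral_formFactor_symm_sub_one_le (hRH : RiemannHypothesis) :
    ∃ C : ℝ, 0 ≤ C ∧ ∀ᶠ T : ℝ in atTop, ∀ lam : ℝ, 0 < lam → lam ≤ 1 →
      |(∫ β in (-lam)..lam, montgomeryFormFactor β T) - 1 - lam ^ 2| ≤
        C / Real.sqrt (Real.log T) + T ^ (-2 * lam) := by
  obtain ⟨C, hC0, hC⟩ := exists_abs_integral_formFactor_zero_sub_half_le hRH
  refine ⟨2 * C, by positivity, ?_⟩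
  filter_upwards [hC] with T hT
  intro lam hlam0 hlam1
  have h := hT lam hlam0 hlam1
  rw [integral_formFactor_symm]
  have e : 2 * (∫ β in (0 : ℝ)..lam, montgomeryFormFactor β T) - 1 - lam ^ 2 =
      2 * ((∫ β in (0 : ℝ)..lam, montgomeryFormFactor β T) - 1 / 2 - lam ^ 2 / 2) := by ring
  rw [e, abs_mul, abs_two]
  have e2 : 2 * C / Real.sqrt (Real.log T) + T ^ (-2 * lam) =
      2 * (C / Real.sqrt (Real.log T) + T ^ (-2 * lam) / 2) := by ring
  rw [e2]
  exact mul_le_mul_of_nonneg_left h zero_le_two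


/-- **(W2′) windows inside `(0, 1)`** (the `|α|`-term of (MT) integrated: BGSTB 2025, Lemma 6 (ii) with
`s(α) = |α|` for `|α| < 1`, here from RH alone): assuming RH there is `C` with, for all large `T` and all
`a, λ` with `0 ≤ λ ≤ a`, `a + λ ≤ 1`, `|∫_{a−λ}^{a+λ} F(β,T) dβ − 2λa| ≤ C/√(log T) + T^{−2(a−λ)}/2`.
[cite: BaluyotGoldstonSuriajayaTurnageButterbaugh2025, §7 (proof of Theorem 3)] -/
theorem exists_abs_integral_formFactor_window_sub_le (hRH : RiemannHypothesis) :
    ∃ C : ℝ, 0 ≤ C ∧ ∀ᶠ T : ℝ in atTop, ∀ a lam : ℝ, 0 ≤ lam → lam ≤ a → a + lam ≤ 1 →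
      |(∫ β in (a - lam)..(a + lam), montgomeryFormFactor β T) - 2 * lam * a| ≤
        C / Real.sqrt (Real.log T) + T ^ (-2 * (a - lam)) / 2 := by
  obtain ⟨C, hC0, hC⟩ := exists_abs_integral_formFactor_sub_le hRH
  refine ⟨C, hC0, ?_⟩
  filter_upwards [hC, eventually_gt_atTop 1] with T hT hT1
  intro a lam hlam0 hlama hal
  have hT0 : 0 < T := by linarith
  have h := hT (a - lam) (a + lam) (by linarith) (by linarith) hal
  have hpos : 0 < T ^ (-2 * (a - lam)) := Real.rpow_pos_of_pos hT0 _
  have hpos' : 0 < T ^ (-2 * (a + lam)) := Real.rpow_pos_of_pos hT0 _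
  have hle : T ^ (-2 * (a + lam)) ≤ T ^ (-2 * (a - lam)) :=
    Real.rpow_le_rpow_of_exponent_le hT1.le (by linarith)
  have e : (∫ β in (a - lam)..(a + lam), montgomeryFormFactor β T) - 2 * lam * a =
      ((∫ β in (a - lam)..(a + lam), montgomeryFormFactor β T) -
        ((T ^ (-2 * (a - lam)) - T ^ (-2 * (a + lam))) / 2 + ((a + lam) ^ 2 - (a - lam) ^ 2) / 2)) +
        (T ^ (-2 * (a - lam)) - T ^ (-2 * (a + lam))) / 2 := by ring
  rw [e]
  refine (abs_add_le _ _).trans ?_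
  rw [abs_of_nonneg (by linarith : 0 ≤ (T ^ (-2 * (a - lam)) - T ^ (-2 * (a + lam))) / 2)]
  linarith

/-- **(MT) near `1`, pointwise**: assuming RH there is `C'` with `F(β, T) ≤ C'` for all large `T` and all
`β ∈ [½, 1]` (there `T^{−2β} log T ≤ T^{−1} log T ≤ 1`, so `F = T^{−2β} log T + β + O(…) ≤ 2 + 2C`).
[cite: BaluyotGoldstonSuriajayaTurnageButterbaugh2025, §6 Lemma 6 (iv)] -/
theorem exists_formFactor_le_of_half_le (hRH : RiemannHypothesis) :
    ∃ C' : ℝ, 0 ≤ C' ∧ ∀ᶠ T : ℝ in atTop, ∀ β : ℝ, 1 / 2 ≤ β → β ≤ 1 → montgomeryFormFactor β T ≤ C' := by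
  obtain ⟨C₃, hC₃⟩ := montgomery_pair_correlation_sqrtLog_Icc hRH
  refine ⟨2 + 2 * |C₃|, by positivity, ?_⟩
  filter_upwards [hC₃, eventually_ge_atTop 3] with T hF hT3
  intro β hβ hβ1
  have hT0 : 0 < T := by linarith
  have hT1 : (1 : ℝ) < T := by linarith
  have hL0 : 0 < Real.log T := Real.log_pos hT1
  have hL1 : 1 ≤ Real.log T := by
    rw [← Real.log_exp 1]
    exact Real.log_le_log (Real.exp_pos 1) (by linarith [Real.exp_one_lt_d9])
  have hs1 : 1 ≤ Real.sqrt (Real.log T) := Real.one_le_sqrt.2 hL1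
  have hLT : Real.log T ≤ T := by linarith [Real.log_le_sub_one_of_pos hT0]
  have h := hF β ⟨by linarith, hβ1⟩
  -- `T^{-2β} log T ≤ T^{-1} log T ≤ 1`
  have hu : T ^ (-2 * β) * Real.log T ≤ 1 := by
    have h1 : T ^ (-2 * β) ≤ T ^ (-1 : ℝ) := Real.rpow_le_rpow_of_exponent_le hT1.le (by linarith)
    rw [Real.rpow_neg_one] at h1
    calc T ^ (-2 * β) * Real.log T ≤ T⁻¹ * Real.log T :=
          mul_le_mul_of_nonneg_right h1 hL0.le
      _ = Real.log T / T := by rw [inv_mul_eq_div]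
      _ ≤ 1 := by rw [div_le_one hT0]; exact hLT
  have hu0 : 0 ≤ T ^ (-2 * β) * Real.log T := by positivity
  have h2 : C₃ * (T ^ (-2 * β) * Real.log T + 1) / Real.sqrt (Real.log T) ≤ 2 * |C₃| := by
    have hs0 : 0 < Real.sqrt (Real.log T) := by positivity
    rw [div_le_iff₀ hs0]
    have : C₃ * (T ^ (-2 * β) * Real.log T + 1) ≤ |C₃| * 2 := by
      calc C₃ * (T ^ (-2 * β) * Real.log T + 1) ≤ |C₃| * (T ^ (-2 * β) * Real.log T + 1) :=
            mul_le_mul_of_nonneg_right (le_abs_self _) (by positivity)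
        _ ≤ |C₃| * 2 := mul_le_mul_of_nonneg_left (by linarith) (abs_nonneg _)
    nlinarith [abs_nonneg C₃]
  linarith [(abs_le.1 h).2]

/-- **The (MT) half of BGSTB 2025, Lemma 6 (iv)** ("`∫_{1−λ}^{1+λ} F(α) dα = ∫_1^{1+λ} F(α) dα + O(λ)`",
i.e. `∫_{1−λ}^{1} F = O(λ)`): assuming RH there is `C'` with `0 ≤ ∫_{1−λ}^1 F(β,T) dβ ≤ C' λ` for all
large `T` and all `0 ≤ λ ≤ ½`. [cite: BaluyotGoldstonSuriajayaTurnageButterbaugh2025, §6 Lemma 6 (iv)] -/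
theorem exists_integral_formFactor_left_of_one_le (hRH : RiemannHypothesis) :
    ∃ C' : ℝ, 0 ≤ C' ∧ ∀ᶠ T : ℝ in atTop, ∀ lam : ℝ, 0 ≤ lam → lam ≤ 1 / 2 →
      0 ≤ ∫ β in (1 - lam)..1, montgomeryFormFactor β T ∧
        ∫ β in (1 - lam)..1, montgomeryFormFactor β T ≤ C' * lam := by
  obtain ⟨C', hC'0, hC'⟩ := exists_formFactor_le_of_half_le hRH
  refine ⟨C', hC'0, ?_⟩
  filter_upwards [hC', eventually_gt_atTop 1] with T hT hT1
  intro lam hlam0 hlam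
  have hle : 1 - lam ≤ 1 := by linarith
  refine ⟨intervalIntegral.integral_nonneg hle fun β _ ↦ montgomeryFormFactor_nonneg β hT1, ?_⟩
  calc ∫ β in (1 - lam)..1, montgomeryFormFactor β T ≤ ∫ β in (1 - lam)..1, C' := by
        refine intervalIntegral.integral_mono_on hle
          ((continuous_formFactor_left T).intervalIntegrable _ _) intervalIntegrable_const ?_
        intro β hβ
        exact hT β (by linarith [hβ.1]) hβ.2
    _ = C' * lam := by rw [intervalIntegral.integral_const, smul_eq_mul]; ring


end Montgomery

end Literature.NumberTheory.LFunctions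

end
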